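import Literature.AnabelianGeometry.SemiGraphs.SubdivisionPathTurns
import Literature.AnabelianGeometry.SemiGraphs.TemperedHbddOfLocalLevelEstrangement
import HarnessLib

/-!
# [SemiAnbd] Thm 3.7 (iii) beyond locally finite `𝔾`: separating vertices of the fixed geodesics lie over base
# vertices of INFINITE valence; the binder `hbdd` at a TAME base graph (abstract level data)

Mochizuki, *Semi-graphs of anabelioids*, Publ. RIMS **42** (2006), §3, Theorem 3.7 (iii), manuscript p. 41 ("if
`H` fixes two vertices of `𝒢_{∞,j}`, then these two vertices are joined to one another by a single edge"), with the
author's *Comments* (2020) (6)(b) [cite: MochizukiSemiAnbd2006, Thm 3.7(iii) p.41].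

PROOF-ONLY (cell abc-iut, block F, FACT-LIST rows F-2772 / F-2773, residual «infinite valence» of GAP row G-t6g3-2b;
seat abc-iut-f-176 gen 3, desk memo `HOME/staging/f/f-176/g3/FINDING-hadj-tame.md`; no definition, no named fact).
Over an ABSTRACT `D : VerticialLevelData 𝒢 c` and a subgroup `C ≤ π₁^temp(𝒢)` satisfying abc-iut-w6-d062's two
depth lemmas MERGED over every FINITE set `B` of branches at a base vertex — the hypothesis `hLE` («from some level
on, two `C`-fixed tree branches at a common vertex over `w` whose base branches lie in `B` have the same image at
the reference level»; at the canonical tower it holds at ANY valence, `leFinset_temperedPiChart` of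
`TemperedHbddOfTame.lean`, whereas the per-VERTEX form (LE_C,w) of `TemperedHbddOfLocalLevelEstrangement.lean`
needs finite valence at `w`):

* `VerticialLevelData.exists_fixed_turn` — for two compatible `C`-fixed vertex systems `x`, `x'` and a vertex `u`
  of `𝒢_{∞,j}` separating `x j` from `x' j`, the `C`-fixed geodesic of a deeper level contains a vertex `ũ` over
  `u` whose two neighbouring branch-points on the geodesic have DISTINCT images at `u`
  (`SemiGraph.exists_turn_getVert` for the transition map);
* `VerticialLevelData.infinite_branches_of_separating` — hence every vertex separating `x j` from `x' j` lies over
  a base vertex of INFINITE valence (`hLE` for all branches of a finite-valence base vertex identifies the two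
  images): the fixed geodesics never pass THROUGH lifts of finite-valence vertices;
* `VerticialLevelData.dist_le_four_of_tame` / `hbdd_of_tame` — if every base vertex of infinite valence has only
  finitely many branches whose edge's OTHER branch abuts a vertex of infinite valence, and finitely many whose
  edge's other branch abuts any given vertex (TAME: every star; infinite-valence vertices pairwise non-adjacent,
  loop-free, of finite edge multiplicity; …), then `dist (x j, x' j) ≤ 4` at every level — the binder `hbdd` of
  abc-iut-L3-t10's `hadj_temperedPiChart_of_bounded_dist'` / `compactInVerticialAt_of_noEscape`: the escaping
  branch at `ũ` continues along the geodesic PATH (edge-point, opposite branch — morphisms are injective on the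
  branches of an edge, `Hom.branchMap_injOn` —, vertex) to an end or to a separating vertex, i.e. over `base x`,
  `base x'` or a vertex of infinite valence, so its base branch was in the finite set after all.

Nothing here asserts `hLE` for any `𝒢` (canonical tower: `TemperedHbddOfTame.lean`); the case of graphs with an
infinitely-branching core (every vertex of some sub-semi-graph of infinite valence in it) is NOT treated; nothing
here bears on [IUTchIII] Cor. 3.12; typed ≠ proved elsewhere.
-/

namespace Literature.AnabelianGeometry.SemiGraphs

/-! ### Over abstract level data: separating vertices lie over infinite-valence base vertices; TAME ⇒ `dist ≤ 4` -/

namespace ProfiniteSemiGraph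

namespace VerticialLevelData

open CategoryTheory Topology

universe v u

variable {𝒢 : ProfiniteSemiGraph.{u}} {c : TemperedPiChart 𝒢} (D : VerticialLevelData.{v} 𝒢 c)

/-- Base vertices along the transition maps: `proj_k (v) = proj_j (trans v)`.
[cite: MochizukiSemiAnbd2006, Thm 3.7(iii) p.41] -/
private theorem proj_trans_vertexMap ⦃j k : D.J⦄ (h : j ≤ k) (v : (D.tree k).Vertex) :
    (D.proj k).vertexMap v = (D.proj j).vertexMap ((D.trans h).vertexMap v) := by
  have e := congrArg (fun φ => SemiGraph.Hom.vertexMap φ v) (D.trans_over h)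
  simpa only [SemiGraph.comp_vertexMap, Function.comp_apply] using e.symm

/-- **The turn on the `C`-fixed geodesic of a deeper level.**  For two compatible `C`-fixed vertex systems `x`, `x'`
and a vertex `u` of `𝒢_{∞,j}` separating `x j` from `x' j`, at every level `K ≥ j` the `C`-fixed geodesic
`[x K, x' K]` (fixed node by node, `nodeMap_eq_self_of_isPath`) contains a vertex `ũ` over `u` whose two neighbouring
branch-points `β₁` (before) and `β₂` (after) on the geodesic have DISTINCT images at `u`
(`SemiGraph.exists_turn_getVert` for the transition map). [cite: MochizukiSemiAnbd2006, Thm 3.7(iii) p.41] -/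
theorem exists_fixed_turn (C : Subgroup c.G) (x x' : ∀ j, (D.tree j).Vertex)
    (hx : ∀ ⦃i j : D.J⦄ (h : i ≤ j), (D.trans h).vertexMap (x j) = x i)
    (hx' : ∀ ⦃i j : D.J⦄ (h : i ≤ j), (D.trans h).vertexMap (x' j) = x' i)
    (hfx : ∀ g ∈ C, ∀ j, (D.act j g).hom.vertexMap (x j) = x j)
    (hfx' : ∀ g ∈ C, ∀ j, (D.act j g).hom.vertexMap (x' j) = x' j)
    {j K : D.J} (hjK : j ≤ K) (u : (D.tree j).Vertex) (hu : u ≠ x j) (hu' : u ≠ x' j)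
    (hsep : ∀ w : (D.tree j).subdivision.Walk (Sum.inl (x j)) (Sum.inl (x' j)),
      (Sum.inl u : (D.tree j).Node) ∈ w.support) :
    ∃ (p : (D.tree K).subdivision.Walk (Sum.inl (x K)) (Sum.inl (x' K))), p.IsPath ∧
      (∀ z ∈ p.support, ∀ g ∈ C, SemiGraph.nodeMap (D.act K g) z = z) ∧
      ∃ (i : ℕ) (ũ : (D.tree K).Vertex) (β₁ β₂ : (D.tree K).Branch),
        i + 2 ≤ p.length ∧ p.getVert i = Sum.inr (Sum.inr β₁) ∧ p.getVert (i + 1) = Sum.inl ũ ∧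
        p.getVert (i + 2) = Sum.inr (Sum.inr β₂) ∧ (D.tree K).abuts β₁ = some ũ ∧
        (D.tree K).abuts β₂ = some ũ ∧ (D.trans hjK).vertexMap ũ = u ∧
        (D.trans hjK).branchMap β₁ ≠ (D.trans hjK).branchMap β₂ := by
  classical
  have hT := (D.isTree K).isTree
  -- the `C`-fixed geodesic at level `K`
  obtain ⟨p, hp⟩ := hT.connected.exists_walk_length_eq_dist (Sum.inl (x K)) (Sum.inl (x' K))
  have hpp : p.IsPath := p.isPath_of_length_eq_dist hp
  have hfix : ∀ z ∈ p.support, ∀ g ∈ C, SemiGraph.nodeMap (D.act K g) z = z := by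
    intro z hz g hg
    have hxn : SemiGraph.nodeMap (D.act K g) (Sum.inl (x K)) = Sum.inl (x K) := by simp [hfx g hg K]
    have hx'n : SemiGraph.nodeMap (D.act K g) (Sum.inl (x' K)) = Sum.inl (x' K) := by simp [hfx' g hg K]
    exact SemiGraph.nodeMap_eq_self_of_isPath hT.isAcyclic _ hxn hx'n p hpp z hz
  -- the turn, for the transition map `𝒢_{∞,K} → 𝒢_{∞,j}`
  have hsep' : ∀ w : (D.tree j).subdivision.Walk (Sum.inl ((D.trans hjK).vertexMap (x K)))
      (Sum.inl ((D.trans hjK).vertexMap (x' K))), (Sum.inl u : (D.tree j).Node) ∈ w.support := by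
    rw [hx hjK, hx' hjK]; exact hsep
  obtain ⟨i, hi, hi1, hi0, hi2, -⟩ := SemiGraph.exists_turn_getVert (D.trans hjK) p u
    (by rw [hx hjK]; exact hu.symm) (by rw [hx' hjK]; exact hu'.symm) hsep'
  obtain ⟨ũ, hũ, hũu⟩ : ∃ v : (D.tree K).Vertex, p.getVert (i + 1) = Sum.inl v ∧
      (D.trans hjK).vertexMap v = u := by
    rcases hz : p.getVert (i + 1) with v | e | b
    · rw [hz] at hi1
      exact ⟨v, rfl, by simpa using hi1⟩
    · rw [hz] at hi1
      simp at hi1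
    · rw [hz] at hi1
      simp at hi1
  -- the two branch-points around `ũ`
  have ha₁ : (D.tree K).subdivision.Adj (Sum.inl ũ) (p.getVert i) := by
    rw [← hũ]; exact (p.adj_getVert_succ (by omega)).symm
  obtain ⟨β₁, hβ₁, hi₁⟩ := ((D.tree K).subdivision_adj_inl_iff ũ _).1 ha₁
  have ha₂ : (D.tree K).subdivision.Adj (Sum.inl ũ) (p.getVert (i + 2)) := by
    rw [← hũ]; exact p.adj_getVert_succ (by omega)
  obtain ⟨β₂, hβ₂, hi₂⟩ := ((D.tree K).subdivision_adj_inl_iff ũ _).1 ha₂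
  refine ⟨p, hpp, hfix, i, ũ, β₁, β₂, hi, hi₁, hũ, hi₂, hβ₁, hβ₂, hũu, fun heq => ?_⟩
  -- distinct images: one branch-point is reached from `x j` avoiding `u`, the other is not
  rw [hi₁] at hi0
  rw [hi₂] at hi2
  obtain ⟨w₀, hw₀⟩ := hi0
  exact hi2 ⟨w₀.copy rfl (by simp [heq]), by rw [SimpleGraph.Walk.support_copy]; exact hw₀⟩

/-- On a walk all of whose nodes are `C`-fixed, the edge of a branch-point is `C`-fixed.
[cite: MochizukiSemiAnbd2006, Thm 3.7(iii) p.41] -/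
private theorem edgeMap_eq_of_fixed_support (C : Subgroup c.G) {K : D.J} {z z' : (D.tree K).Node}
    {p : (D.tree K).subdivision.Walk z z'}
    (hfix : ∀ z ∈ p.support, ∀ g ∈ C, SemiGraph.nodeMap (D.act K g) z = z)
    (β : (D.tree K).Branch) (hβ : (Sum.inr (Sum.inr β) : (D.tree K).Node) ∈ p.support) :
    ∀ g ∈ C, (D.act K g).hom.edgeMap ((D.tree K).edgeOf β) = (D.tree K).edgeOf β := by
  intro g hg
  have h := hfix _ hβ g hg
  simp only [SemiGraph.nodeMap_inr_inr, Sum.inr.injEq] at h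
  rw [← (D.act K g).hom.edgeOf_branchMap β, h]

/-- **Separating vertices lie over base vertices of INFINITE valence.**  Let `D` be level data, `C` a subgroup
for which the two depth lemmas hold merged over every FINITE set `B` of branches at a base vertex (`hLE`: from some
level on, two `C`-fixed tree branches at a common vertex over `w` with base branches in `B` have the same image at
the reference level), and `x`, `x'` compatible `C`-fixed vertex systems.  Then every vertex `u` of `𝒢_{∞,j}`
separating `x j` from `x' j` lies over a base vertex with infinitely many branches: otherwise `hLE` for ALL
branches at that base vertex, applied at the vertex `ũ` of `exists_fixed_turn`, identifies the two distinct images.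
[cite: MochizukiSemiAnbd2006, Thm 3.7(iii) p.41] -/
theorem infinite_branches_of_separating (C : Subgroup c.G)
    (hLE : ∀ (w : 𝒢.graph.Vertex) (B : Set 𝒢.graph.Branch), B.Finite →
      (∀ b ∈ B, 𝒢.graph.abuts b = some w) → ∀ j : D.J, ∃ (k : D.J) (hjk : j ≤ k),
      ∀ (v : (D.tree k).Vertex), (D.proj k).vertexMap v = w →
      ∀ (β₁ β₂ : (D.tree k).Branch), (D.tree k).abuts β₁ = some v → (D.tree k).abuts β₂ = some v →
      (D.proj k).branchMap β₁ ∈ B → (D.proj k).branchMap β₂ ∈ B →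
      (∀ g ∈ C, (D.act k g).hom.edgeMap ((D.tree k).edgeOf β₁) = (D.tree k).edgeOf β₁) →
      (∀ g ∈ C, (D.act k g).hom.edgeMap ((D.tree k).edgeOf β₂) = (D.tree k).edgeOf β₂) →
      (D.trans hjk).branchMap β₁ = (D.trans hjk).branchMap β₂)
    (x x' : ∀ j, (D.tree j).Vertex)
    (hx : ∀ ⦃i j : D.J⦄ (h : i ≤ j), (D.trans h).vertexMap (x j) = x i)
    (hx' : ∀ ⦃i j : D.J⦄ (h : i ≤ j), (D.trans h).vertexMap (x' j) = x' i)
    (hfx : ∀ g ∈ C, ∀ j, (D.act j g).hom.vertexMap (x j) = x j)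
    (hfx' : ∀ g ∈ C, ∀ j, (D.act j g).hom.vertexMap (x' j) = x' j)
    (j : D.J) (u : (D.tree j).Vertex) (hu : u ≠ x j) (hu' : u ≠ x' j)
    (hsep : ∀ w : (D.tree j).subdivision.Walk (Sum.inl (x j)) (Sum.inl (x' j)),
      (Sum.inl u : (D.tree j).Node) ∈ w.support) :
    {b : 𝒢.graph.Branch | 𝒢.graph.abuts b = some ((D.proj j).vertexMap u)}.Infinite := by
  intro hfin
  obtain ⟨K, hjK, hK⟩ := hLE ((D.proj j).vertexMap u) _ hfin (fun b hb => hb) j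
  obtain ⟨p, -, hfix, i, ũ, β₁, β₂, hi, hi₁, -, hi₂, hβ₁, hβ₂, hũu, hne⟩ :=
    D.exists_fixed_turn C x x' hx hx' hfx hfx' hjK u hu hu' hsep
  have hũw : (D.proj K).vertexMap ũ = (D.proj j).vertexMap u := by rw [D.proj_trans_vertexMap hjK, hũu]
  refine hne (hK ũ hũw β₁ β₂ hβ₁ hβ₂ ?_ ?_
    (D.edgeMap_eq_of_fixed_support C hfix β₁ (hi₁ ▸ p.getVert_mem_support i))
    (D.edgeMap_eq_of_fixed_support C hfix β₂ (hi₂ ▸ p.getVert_mem_support (i + 2))))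
  · show 𝒢.graph.abuts ((D.proj K).branchMap β₁) = some ((D.proj j).vertexMap u)
    rw [(D.proj K).abuts_branchMap β₁ ũ hβ₁, hũw]
  · show 𝒢.graph.abuts ((D.proj K).branchMap β₂) = some ((D.proj j).vertexMap u)
    rw [(D.proj K).abuts_branchMap β₂ ũ hβ₂, hũw]

/-- **TAME ⇒ `dist ≤ 4`** ([SemiAnbd] Thm 3.7 (iii), second sentence, beyond locally finite `𝔾`).  With `D`, `C`,
`hLE`, `x`, `x'` as in `infinite_branches_of_separating`, suppose every base vertex `w` of infinite valence carries
only finitely many branches whose edge has ANOTHER branch abutting a vertex of infinite valence (`hTinf`) and, for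
every vertex `a`, only finitely many whose edge has another branch abutting `a` (`hTmul`).  Then `x j`, `x' j` are
equal or the two ends of one edge at every level.  If not, the separating vertex `u` at position `4` of the geodesic
lies over an infinite-valence `w`; the finite set `B` of branches at `w` leading to infinite valence, to `base x` or
to `base x'` folds (`hLE`); so one of the two branches at the vertex `ũ` of `exists_fixed_turn` has base branch
outside `B` — but along the geodesic PATH it continues (edge-point, opposite branch — `Hom.branchMap_injOn` — vertex)
to an end of the geodesic or to a separating vertex, i.e. over `base x`, `base x'` or infinite valence.
[cite: MochizukiSemiAnbd2006, Thm 3.7(iii) p.41] -/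
theorem dist_le_four_of_tame (C : Subgroup c.G)
    (hLE : ∀ (w : 𝒢.graph.Vertex) (B : Set 𝒢.graph.Branch), B.Finite →
      (∀ b ∈ B, 𝒢.graph.abuts b = some w) → ∀ j : D.J, ∃ (k : D.J) (hjk : j ≤ k),
      ∀ (v : (D.tree k).Vertex), (D.proj k).vertexMap v = w →
      ∀ (β₁ β₂ : (D.tree k).Branch), (D.tree k).abuts β₁ = some v → (D.tree k).abuts β₂ = some v →
      (D.proj k).branchMap β₁ ∈ B → (D.proj k).branchMap β₂ ∈ B →
      (∀ g ∈ C, (D.act k g).hom.edgeMap ((D.tree k).edgeOf β₁) = (D.tree k).edgeOf β₁) →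
      (∀ g ∈ C, (D.act k g).hom.edgeMap ((D.tree k).edgeOf β₂) = (D.tree k).edgeOf β₂) →
      (D.trans hjk).branchMap β₁ = (D.trans hjk).branchMap β₂)
    (hTinf : ∀ w : 𝒢.graph.Vertex, {b | 𝒢.graph.abuts b = some w}.Infinite →
      {b : 𝒢.graph.Branch | 𝒢.graph.abuts b = some w ∧ ∃ b', b' ≠ b ∧ 𝒢.graph.edgeOf b' = 𝒢.graph.edgeOf b ∧
        ∃ w', 𝒢.graph.abuts b' = some w' ∧ {b'' | 𝒢.graph.abuts b'' = some w'}.Infinite}.Finite)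
    (hTmul : ∀ w a : 𝒢.graph.Vertex, {b | 𝒢.graph.abuts b = some w}.Infinite →
      {b : 𝒢.graph.Branch | 𝒢.graph.abuts b = some w ∧ ∃ b', b' ≠ b ∧ 𝒢.graph.edgeOf b' = 𝒢.graph.edgeOf b ∧
        𝒢.graph.abuts b' = some a}.Finite)
    (x x' : ∀ j, (D.tree j).Vertex)
    (hx : ∀ ⦃i j : D.J⦄ (h : i ≤ j), (D.trans h).vertexMap (x j) = x i)
    (hx' : ∀ ⦃i j : D.J⦄ (h : i ≤ j), (D.trans h).vertexMap (x' j) = x' i)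
    (hfx : ∀ g ∈ C, ∀ j, (D.act j g).hom.vertexMap (x j) = x j)
    (hfx' : ∀ g ∈ C, ∀ j, (D.act j g).hom.vertexMap (x' j) = x' j) (j : D.J) :
    (D.tree j).subdivision.dist (Sum.inl (x j)) (Sum.inl (x' j)) ≤ 4 := by
  classical
  by_contra hfar
  obtain ⟨u, hu, hu', hsep⟩ := SemiGraph.exists_separating_of_four_lt_dist (D.isTree j).isTree hfar
  -- base points
  set w := (D.proj j).vertexMap u with hw
  set a := (D.proj j).vertexMap (x j) with ha
  set a' := (D.proj j).vertexMap (x' j) with ha'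
  have hwinf : {b | 𝒢.graph.abuts b = some w}.Infinite :=
    D.infinite_branches_of_separating C hLE x x' hx hx' hfx hfx' j u hu hu' hsep
  -- the finite branch set at `w`
  let B : Set 𝒢.graph.Branch := {b | 𝒢.graph.abuts b = some w ∧ ∃ b', b' ≠ b ∧
    𝒢.graph.edgeOf b' = 𝒢.graph.edgeOf b ∧ ∃ w', 𝒢.graph.abuts b' = some w' ∧
      ({b'' | 𝒢.graph.abuts b'' = some w'}.Infinite ∨ w' = a ∨ w' = a')}
  have hBfin : B.Finite := by
    refine ((hTinf w hwinf).union ((hTmul w a hwinf).union (hTmul w a' hwinf))).subset ?_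
    rintro b ⟨hb, b', hb'b, hb'e, w', hb'w, hw' | rfl | rfl⟩
    · exact Or.inl ⟨hb, b', hb'b, hb'e, w', hb'w, hw'⟩
    · exact Or.inr (Or.inl ⟨hb, b', hb'b, hb'e, hb'w⟩)
    · exact Or.inr (Or.inr ⟨hb, b', hb'b, hb'e, hb'w⟩)
  obtain ⟨K, hjK, hK⟩ := hLE w B hBfin (fun b hb => hb.1) j
  obtain ⟨p, hpp, hfix, i, ũ, β₁, β₂, hi, hi₁, hũ, hi₂, hβ₁, hβ₂, hũu, hne⟩ :=
    D.exists_fixed_turn C x x' hx hx' hfx hfx' hjK u hu hu' hsep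
  have hTK := (D.isTree K).isTree
  have hũw : (D.proj K).vertexMap ũ = w := by rw [D.proj_trans_vertexMap hjK, hũu]
  -- not both base branches in `B`
  have hout : (D.proj K).branchMap β₁ ∉ B ∨ (D.proj K).branchMap β₂ ∉ B := by
    by_contra h
    rw [not_or, not_not, not_not] at h
    exact hne (hK ũ hũw β₁ β₂ hβ₁ hβ₂ h.1 h.2
      (D.edgeMap_eq_of_fixed_support C hfix β₁ (hi₁ ▸ p.getVert_mem_support i))
      (D.edgeMap_eq_of_fixed_support C hfix β₂ (hi₂ ▸ p.getVert_mem_support (i + 2))))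
  -- a vertex of the geodesic lies over `a`, over `a'`, or over an infinite-valence vertex
  have hvert : ∀ (n : ℕ) (v : (D.tree K).Vertex), n ≤ p.length → p.getVert n = Sum.inl v →
      (D.proj K).vertexMap v = a ∨ (D.proj K).vertexMap v = a' ∨
        {b'' | 𝒢.graph.abuts b'' = some ((D.proj K).vertexMap v)}.Infinite := by
    intro n v hn hv
    by_cases h0 : n = 0
    · subst h0
      rw [SimpleGraph.Walk.getVert_zero] at hv
      have hvx : v = x K := (Sum.inl_injective hv).symm
      left
      rw [hvx, D.proj_trans_vertexMap hjK, hx hjK]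
    by_cases hl : n = p.length
    · subst hl
      rw [SimpleGraph.Walk.getVert_length] at hv
      have hvx : v = x' K := (Sum.inl_injective hv).symm
      right; left
      rw [hvx, D.proj_trans_vertexMap hjK, hx' hjK]
    · right; right
      have hvx : v ≠ x K := by
        rintro rfl
        refine h0 (hpp.getVert_injOn (by rw [Set.mem_setOf_eq]; omega) (by rw [Set.mem_setOf_eq]; omega) ?_)
        rw [hv, SimpleGraph.Walk.getVert_zero]
      have hvx' : v ≠ x' K := by
        rintro rfl
        refine hl (hpp.getVert_injOn (by rw [Set.mem_setOf_eq]; omega) (by rw [Set.mem_setOf_eq]) ?_)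
        rw [hv, SimpleGraph.Walk.getVert_length]
      exact D.infinite_branches_of_separating C hLE x x' hx hx' hfx hfx' K v hvx hvx'
        fun w' => SemiGraph.mem_support_of_mem_support_path hTK.isAcyclic p hpp
          (hv ▸ p.getVert_mem_support n) w'
  rcases hout with h₁ | h₂
  · -- backwards along the geodesic: `β₁`'s edge leads to `p_{i-3}`
    obtain ⟨β₁', v', hβ₁'ne, hβ₁'e, hβ₁'v, h3i, hv'⟩ :=
      SemiGraph.exists_getVert_sub_three hpp (by omega) hũ hi₁
    refine h₁ ⟨by rw [(D.proj K).abuts_branchMap β₁ ũ hβ₁, hũw], (D.proj K).branchMap β₁',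
      fun h => hβ₁'ne ((D.proj K).branchMap_injOn _ _ hβ₁'e h),
      by rw [(D.proj K).edgeOf_branchMap, (D.proj K).edgeOf_branchMap, hβ₁'e],
      (D.proj K).vertexMap v', (D.proj K).abuts_branchMap β₁' v' hβ₁'v, ?_⟩
    rcases hvert (i - 3) v' (by omega) hv' with h | h | h
    · exact Or.inr (Or.inl h)
    · exact Or.inr (Or.inr h)
    · exact Or.inl h
  · -- forwards along the geodesic: `β₂`'s edge leads to `p_{i+5}`
    obtain ⟨β₂', v', hβ₂'ne, hβ₂'e, hβ₂'v, hi5, hv'⟩ :=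
      SemiGraph.exists_getVert_add_five hpp hi hũ hi₂
    refine h₂ ⟨by rw [(D.proj K).abuts_branchMap β₂ ũ hβ₂, hũw], (D.proj K).branchMap β₂',
      fun h => hβ₂'ne ((D.proj K).branchMap_injOn _ _ hβ₂'e h),
      by rw [(D.proj K).edgeOf_branchMap, (D.proj K).edgeOf_branchMap, hβ₂'e],
      (D.proj K).vertexMap v', (D.proj K).abuts_branchMap β₂' v' hβ₂'v, ?_⟩
    rcases hvert (i + 5) v' hi5 hv' with h | h | h
    · exact Or.inr (Or.inl h)
    · exact Or.inr (Or.inr h)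
    · exact Or.inl h

/-- **The binder `hbdd` (bound `4`) over abstract level data at a TAME base graph.**
[cite: MochizukiSemiAnbd2006, Thm 3.7(iii) p.41] -/
theorem hbdd_of_tame (C : Subgroup c.G)
    (hLE : ∀ (w : 𝒢.graph.Vertex) (B : Set 𝒢.graph.Branch), B.Finite →
      (∀ b ∈ B, 𝒢.graph.abuts b = some w) → ∀ j : D.J, ∃ (k : D.J) (hjk : j ≤ k),
      ∀ (v : (D.tree k).Vertex), (D.proj k).vertexMap v = w →
      ∀ (β₁ β₂ : (D.tree k).Branch), (D.tree k).abuts β₁ = some v → (D.tree k).abuts β₂ = some v →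
      (D.proj k).branchMap β₁ ∈ B → (D.proj k).branchMap β₂ ∈ B →
      (∀ g ∈ C, (D.act k g).hom.edgeMap ((D.tree k).edgeOf β₁) = (D.tree k).edgeOf β₁) →
      (∀ g ∈ C, (D.act k g).hom.edgeMap ((D.tree k).edgeOf β₂) = (D.tree k).edgeOf β₂) →
      (D.trans hjk).branchMap β₁ = (D.trans hjk).branchMap β₂)
    (hTinf : ∀ w : 𝒢.graph.Vertex, {b | 𝒢.graph.abuts b = some w}.Infinite →
      {b : 𝒢.graph.Branch | 𝒢.graph.abuts b = some w ∧ ∃ b', b' ≠ b ∧ 𝒢.graph.edgeOf b' = 𝒢.graph.edgeOf b ∧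
        ∃ w', 𝒢.graph.abuts b' = some w' ∧ {b'' | 𝒢.graph.abuts b'' = some w'}.Infinite}.Finite)
    (hTmul : ∀ w a : 𝒢.graph.Vertex, {b | 𝒢.graph.abuts b = some w}.Infinite →
      {b : 𝒢.graph.Branch | 𝒢.graph.abuts b = some w ∧ ∃ b', b' ≠ b ∧ 𝒢.graph.edgeOf b' = 𝒢.graph.edgeOf b ∧
        𝒢.graph.abuts b' = some a}.Finite)
    (x x' : ∀ j, (D.tree j).Vertex)
    (hx : ∀ ⦃i j : D.J⦄ (h : i ≤ j), (D.trans h).vertexMap (x j) = x i)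
    (hx' : ∀ ⦃i j : D.J⦄ (h : i ≤ j), (D.trans h).vertexMap (x' j) = x' i)
    (hfx : ∀ g ∈ C, ∀ j, (D.act j g).hom.vertexMap (x j) = x j)
    (hfx' : ∀ g ∈ C, ∀ j, (D.act j g).hom.vertexMap (x' j) = x' j) :
    ∃ N : ℕ, ∀ j, (D.tree j).subdivision.dist (Sum.inl (x j)) (Sum.inl (x' j)) ≤ N :=
  ⟨4, D.dist_le_four_of_tame C hLE hTinf hTmul x x' hx hx' hfx hfx'⟩

end VerticialLevelData

end ProfiniteSemiGraph

end Literature.AnabelianGeometry.SemiGraphs
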